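import Literature.Barriers.FinalStateConjecture.NonSmoothNullInfinityVExpansion
import Mathlib.Analysis.SpecialFunctions.Integrals.Basic
import HarnessLib

/-!
# Barrier catalogue `FinalStateConjecture`: the linear scattering problem on Schwarzschild —
# the logarithmic integral along ingoing null rays
(`Literature/Barriers/FinalStateConjecture/`, D-0021, D-0014; namespace
`Literature.Barriers.FinalStateConjecture`, sub-namespace `VExp`)

The logarithm in Kehrberger's expansion (6.18) of `∂ᵥ(rφ)` (arXiv:2105.08079v3, Thm. 4.3/6.2 and the
heuristic computation of §2.1, eq. (2.15): "`∂ᵥ(rφ)(u,v) ∼ −∫_{−∞}^{u} du'/(r(u',v)³|u'|) ∼ [...] =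
(log|u| − log(v−u))/v³ + …`") comes from integrating the `|u'|⁻²`-tail of the radiation field against
the potential `∼ 1/r(u',v)³` from `𝓘⁻`. For an Eddington–Finkelstein area radius `r`
(`∂ᵤ r = −(1 − 2M/r)`) this file computes that integral to the precision needed: with `ρ₀ = 1/r(u,v)`,
`Λ = log r(u,v) − log|u|`, at fixed `u < 0` and as `v → ∞` (`r(u, v) ≥ max(4M, |u|)`),

* `VExp.Jint r k u v = ∫_{−∞}^{u} u'⁻² (r(u',v)^{−k} − r(u,v)^{−k}) du'` and
  `VExp.Iint M r j u v = ∫_{−∞}^{u} (1 − 2M/r) r(u',v)^{−j}/|u'| du'`, with the integration by parts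
  `J_k = −k I_{k+1}` (`VExp.Jint_eq`);
* the model integrals `𝒩_j(c) = ∫_{−∞}^{u} du'/(|u'| (c + u − u')^j) = (log c − log|u|)/c^j + O(c^{−j})`
  (`VExp.abs_modelInt_sub_le`: split at `u' = u − c`, compare with `∫_{u−c}^{u} du'/(|u'| c^j) =
  (log(c+|u|) − log|u|)/c^j`);
* the squeeze `r₀ + θ(u−u') ≤ r(u',v) ≤ r₀ + (u−u')`, `θ ≤ 1 − 2M/r(u',v) ≤ 1` (`θ = 1 − 2M/r₀`) and
  hence **`|I_j − Λ ρ₀^j| ≤ C ρ₀^j`**, **`|J_k + k Λ ρ₀^{k+1}| ≤ C ρ₀^{k+1}`** (`VExp.abs_Iint_sub_le`,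
  `VExp.abs_Jint_add_le`) — the constants depend on `u`;
* the kernel bound `0 ≤ ρ₀^k − ρ(u',v)^k ≤ k ρ₀^{k+1} (u − u')` (`VExp.inv_pow_sub_le`) and
  `∫_{−∞}^{u} log|u'|/u'² du' = (log|u| + 1)/|u|` (`VExp.integral_Iic_log_div_sq`), which control the
  contribution of the `O(log|u'|/|u'|³)` part of the radiation field.

Elementary real analysis; [folklore] throughout, the setting being Kehrberger's §2.1 and §4.2.

## References

* L. M. A. Kehrberger, *The case against smooth null infinity I*, Ann. Henri Poincaré 23 (2022)
  829–921 = arXiv:2105.08079 (v3, 2023), §2.1 eq. (2.15), proof of Thm. 4.3. Key `Kehrberger2022AHP`.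
-/

noncomputable section

open Set Filter Topology MeasureTheory intervalIntegral Function Asymptotics Polynomial
open Literature.Barriers.FinalStateConjecture.ScatDecay

namespace Literature.Barriers.FinalStateConjecture

namespace VExp

/-! ### Along the ingoing ray `u' ≤ u` -/

section Ray

variable {M : ℝ} {r : ℝ → ℝ → ℝ} (hr : IsEFAreaRadius M r) (hM : 0 < M)
include hr hM

/-- `r(u', v) ≤ r(u, v) + (u − u')` for `u' ≤ u` (`∂ᵤ r = −(1 − 2M/r) ≥ −1`). [folklore] -/
lemma radius_ray_le {u u' v : ℝ} (hu' : u' ≤ u) : r u' v ≤ r u v + (u - u') := by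
  have hd : ∀ x, HasDerivAt (fun x ↦ r x v + x) (-(1 - 2 * M / r x v) + 1) x :=
    fun x ↦ (hr.2.2 x v).add (hasDerivAt_id x)
  have hmono : Monotone (fun x ↦ r x v + x) := by
    refine monotone_of_deriv_nonneg (fun x ↦ (hd x).differentiableAt) fun x ↦ ?_
    rw [(hd x).deriv]
    have h0 : 0 < r x v := hr.pos hM.le x v
    have : 0 ≤ 2 * M / r x v := by positivity
    linarith
  have := hmono hu'
  simp only at this
  linarith

/-- `r(u, v) + (1 − 2M/r(u,v))(u − u') ≤ r(u', v)` for `u' ≤ u` (`∂ᵤ r ≤ −(1 − 2M/r(u,v))` along the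
ray, `r` being larger there). [folklore] -/
lemma radius_ray_ge {u u' v : ℝ} (hu' : u' ≤ u) : r u v + (1 - 2 * M / r u v) * (u - u') ≤ r u' v := by
  set θ := 1 - 2 * M / r u v with hθ
  have hanti : AntitoneOn (fun x ↦ r x v + θ * x) (Iic u) := by
    have hd : ∀ x, HasDerivAt (fun x ↦ r x v + θ * x) (-(1 - 2 * M / r x v) + θ * 1) x :=
      fun x ↦ (hr.2.2 x v).add ((hasDerivAt_id x).const_mul θ)
    refine antitoneOn_of_deriv_nonpos (convex_Iic u) (fun x _ ↦ (hd x).continuousAt.continuousWithinAt)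
      (fun x _ ↦ (hd x).differentiableAt.differentiableWithinAt) fun x hx ↦ ?_
    rw [interior_Iic] at hx
    rw [(hd x).deriv]
    have h1 : r u v ≤ r x v := (hr.strictAnti_left hM v).antitone (le_of_lt hx)
    have h0 : 0 < r u v := hr.pos hM.le u v
    have h2 : 2 * M / r x v ≤ 2 * M / r u v := by gcongr
    simp only [hθ]; linarith
  have := hanti (mem_Iic.2 hu') (mem_Iic.2 le_rfl) hu'
  simp only at this
  linarith

/-- `1 − 2M/r(u, v) ≤ 1 − 2M/r(u', v) ≤ 1` for `u' ≤ u`. [folklore] -/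
lemma factor_ray_ge {u u' v : ℝ} (hu' : u' ≤ u) : 1 - 2 * M / r u v ≤ 1 - 2 * M / r u' v := by
  have h1 : r u v ≤ r u' v := (hr.strictAnti_left hM v).antitone hu'
  have h0 : 0 < r u v := hr.pos hM.le u v
  have h2 : 2 * M / r u' v ≤ 2 * M / r u v := by gcongr
  linarith

/-- `1 − 2M/r ≤ 1`. [folklore] -/
lemma factor_le_one (u v : ℝ) : 1 - 2 * M / r u v ≤ 1 := by
  have := hr.pos hM.le u v; have : 0 ≤ 2 * M / r u v := by positivity
  linarith

/-- **`∫_{−∞}^{u} r(u',v)^{−(n+2)} du' ≤ 2 r(u,v)^{−(n+1)}/(n+1)` once `r(u,v) ≥ 4M`**, with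
integrability (the version of `integral_Iic_radius_inv_pow` without the region structure).
[folklore] -/
theorem integral_Iic_inv_pow_ray (n : ℕ) {u v : ℝ} (h4 : 4 * M ≤ r u v) :
    IntegrableOn (fun u' ↦ (r u' v ^ (n + 2))⁻¹) (Iic u) ∧
      ∫ u' in Iic u, (r u' v ^ (n + 2))⁻¹ ≤ 2 * (((n : ℝ) + 1) * r u v ^ (n + 1))⁻¹ := by
  set g : ℝ → ℝ := fun u' ↦ (((n : ℝ) + 1) * r u' v ^ (n + 1))⁻¹ with hg
  set g' : ℝ → ℝ := fun u' ↦ (1 - 2 * M / r u' v) / r u' v ^ (n + 2) with hg'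
  have hderiv : ∀ x ∈ Iic u, HasDerivAt g (g' x) x := by
    intro x _
    have h0 : r x v ≠ 0 := (hr.pos hM.le x v).ne'
    have hc : HasDerivAt (fun u' : ℝ ↦ ((n : ℝ) + 1) * r u' v ^ (n + 1))
        (((n : ℝ) + 1) * (((n + 1 : ℕ) : ℝ) * r x v ^ (n + 1 - 1) * -(1 - 2 * M / r x v))) x :=
      ((hr.2.2 x v).pow (n + 1)).const_mul _
    have hne : ((n : ℝ) + 1) * r x v ^ (n + 1) ≠ 0 := by
      have := hr.pos hM.le x v; positivity
    refine (hc.inv hne).congr_deriv ?_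
    rw [Nat.add_sub_cancel]
    simp only [hg']
    push_cast
    field_simp
    ring
  have hpos : ∀ x ∈ Iic u, 0 ≤ g' x := fun x _ ↦ by
    simp only [hg']
    exact div_nonneg (hr.factor_pos hM.le x v).le (pow_nonneg (hr.pos hM.le x v).le _)
  have hlim : Tendsto g atBot (𝓝 0) := by
    have h1 : Tendsto (fun u' : ℝ ↦ ((n : ℝ) + 1) * r u' v ^ (n + 1)) atBot atTop :=
      Tendsto.const_mul_atTop (by positivity)
        ((tendsto_pow_atTop (by omega)).comp (hr.tendsto_atBot hM.le v))
    exact h1.inv_tendsto_atTop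
  have hint : IntegrableOn g' (Iic u) := integrableOn_Iic_deriv_of_nonneg' hderiv hpos hlim
  have hval : ∫ x in Iic u, g' x = g u - 0 := integral_Iic_of_hasDerivAt_of_tendsto' hderiv hint hlim
  have hcmp : ∀ x ∈ Iic u, (r x v ^ (n + 2))⁻¹ ≤ 2 * g' x := by
    intro x hx
    have h4x : 4 * M ≤ r x v := h4.trans ((hr.strictAnti_left hM v).antitone (mem_Iic.1 hx))
    have hD := factor_ge_half hM h4x
    have hp : 0 < r x v ^ (n + 2) := pow_pos (hr.pos hM.le x v) _
    simp only [hg']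
    rw [inv_eq_one_div, mul_div_assoc', div_le_div_iff_of_pos_right hp]
    linarith
  have hc : Continuous fun u' ↦ (r u' v ^ (n + 2))⁻¹ :=
    ((continuous_slice_left (hr.contDiff_uncurry hM).continuous v).pow _).inv₀
      fun u' ↦ pow_ne_zero _ (hr.pos hM.le u' v).ne'
  have hint2 : IntegrableOn (fun u' ↦ (r u' v ^ (n + 2))⁻¹) (Iic u) := by
    refine Integrable.mono' (hint.const_mul 2) hc.aestronglyMeasurable ?_
    refine (ae_restrict_iff' measurableSet_Iic).2 (Eventually.of_forall fun x hx ↦ ?_)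
    rw [Real.norm_eq_abs, abs_of_pos (by have := hr.pos hM.le x v; positivity)]
    exact hcmp x hx
  refine ⟨hint2, ?_⟩
  calc ∫ u' in Iic u, (r u' v ^ (n + 2))⁻¹ ≤ ∫ u' in Iic u, 2 * g' u' :=
        setIntegral_mono_on hint2 (hint.const_mul 2) measurableSet_Iic hcmp
    _ = 2 * (g u - 0) := by rw [MeasureTheory.integral_const_mul, hval]
    _ = 2 * (((n : ℝ) + 1) * r u v ^ (n + 1))⁻¹ := by simp [hg]

/-- `∂ᵤ (1/r^k) = k ρ^{k+1} (1 − 2M/r)`. [folklore] -/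
lemma hasDerivAt_inv_pow_left (k : ℕ) (u v : ℝ) :
    HasDerivAt (fun u' ↦ (r u' v ^ (k + 1))⁻¹)
      (((k : ℝ) + 1) * ((r u v)⁻¹) ^ (k + 2) * (1 - 2 * M * (r u v)⁻¹)) u := by
  have h := (hasDerivAt_invRadius_left hr hM u v).pow (k + 1)
  have hfun : (fun u' ↦ (r u' v ^ (k + 1))⁻¹) = fun u' ↦ ((r u' v)⁻¹) ^ (k + 1) := by
    funext u'; rw [inv_pow]
  rw [hfun]
  refine h.congr_deriv ?_
  simp only [Nat.add_sub_cancel, invRadiusDerivPoly, eval_sub, eval_mul, eval_pow, eval_X, eval_C]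
  push_cast
  ring

/-- **The kernel bound**: `0 ≤ ρ₀^{k+1} − ρ(u',v)^{k+1} ≤ (k+1) ρ₀^{k+2} (u − u')` for `u' ≤ u`
(`ρ = 1/r`, `ρ₀ = ρ(u, v)`). [folklore] -/
theorem inv_pow_sub_le (k : ℕ) {u u' v : ℝ} (hu' : u' ≤ u) :
    (r u v ^ (k + 1))⁻¹ - (r u' v ^ (k + 1))⁻¹ ≤ ((k : ℝ) + 1) * (r u v ^ (k + 2))⁻¹ * (u - u') := by
  -- `ψ(u') = ρ(u')^{k+1} − (k+1) ρ₀^{k+2} u'` is antitone on `(−∞, u]`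
  set c := ((k : ℝ) + 1) * ((r u v)⁻¹) ^ (k + 2) with hc
  have hd : ∀ x, HasDerivAt (fun x ↦ (r x v ^ (k + 1))⁻¹ - c * x)
      (((k : ℝ) + 1) * ((r x v)⁻¹) ^ (k + 2) * (1 - 2 * M * (r x v)⁻¹) - c * 1) x :=
    fun x ↦ (hasDerivAt_inv_pow_left hr hM k x v).sub ((hasDerivAt_id x).const_mul c)
  have hanti : AntitoneOn (fun x ↦ (r x v ^ (k + 1))⁻¹ - c * x) (Iic u) := by
    refine antitoneOn_of_deriv_nonpos (convex_Iic u) (fun x _ ↦ (hd x).continuousAt.continuousWithinAt)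
      (fun x _ ↦ (hd x).differentiableAt.differentiableWithinAt) fun x hx ↦ ?_
    rw [interior_Iic] at hx
    rw [(hd x).deriv, mul_one, sub_nonpos, hc]
    have hx0 : 0 < r x v := hr.pos hM.le x v
    have hu0 : 0 < r u v := hr.pos hM.le u v
    have hρ : (r x v)⁻¹ ≤ (r u v)⁻¹ :=
      (inv_le_inv₀ hx0 hu0).2 ((hr.strictAnti_left hM v).antitone (le_of_lt hx))
    have h1 : ((r x v)⁻¹) ^ (k + 2) ≤ ((r u v)⁻¹) ^ (k + 2) := pow_le_pow_left₀ (by positivity) hρ _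
    have h2 : 1 - 2 * M * (r x v)⁻¹ ≤ 1 := by
      have : 0 ≤ 2 * M * (r x v)⁻¹ := by positivity
      linarith
    have h3 : 0 ≤ 1 - 2 * M * (r x v)⁻¹ := by
      have := (hr.factor_pos hM.le x v).le; rwa [div_eq_mul_inv] at this
    calc ((k : ℝ) + 1) * ((r x v)⁻¹) ^ (k + 2) * (1 - 2 * M * (r x v)⁻¹)
        ≤ ((k : ℝ) + 1) * ((r x v)⁻¹) ^ (k + 2) * 1 :=
          mul_le_mul_of_nonneg_left h2 (by positivity)
      _ ≤ ((k : ℝ) + 1) * ((r u v)⁻¹) ^ (k + 2) := by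
          rw [mul_one]; exact mul_le_mul_of_nonneg_left h1 (by positivity)
  have := hanti (mem_Iic.2 hu') (mem_Iic.2 le_rfl) hu'
  simp only at this
  have key : (r u v ^ (k + 1))⁻¹ - (r u' v ^ (k + 1))⁻¹ ≤ c * (u - u') := by linarith
  calc (r u v ^ (k + 1))⁻¹ - (r u' v ^ (k + 1))⁻¹ ≤ c * (u - u') := key
    _ = ((k : ℝ) + 1) * (r u v ^ (k + 2))⁻¹ * (u - u') := by rw [hc, inv_pow]

/-- `ρ(u', v)^k ≤ ρ₀^k` for `u' ≤ u`. [folklore] -/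
lemma inv_pow_sub_nonneg (k : ℕ) {u u' v : ℝ} (hu' : u' ≤ u) : 0 ≤ (r u v ^ k)⁻¹ - (r u' v ^ k)⁻¹ :=
  sub_nonneg.2 (inv_radius_pow_le_of_le hr hM hu' k)

end Ray

/-! ### `∫_{−∞}^{u} log|u'|/u'² du'` -/

/-- **`∫_{−∞}^{u} log(−u')/u'² du' = (log(−u) + 1)/(−u)`** for `u ≤ −1`, with integrability
(antiderivative `(log(−u') + 1)/(−u')`). [folklore] -/
theorem integral_Iic_log_div_sq {u : ℝ} (hu : u ≤ -1) :
    IntegrableOn (fun u' ↦ Real.log (-u') / u' ^ 2) (Iic u) ∧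
      ∫ u' in Iic u, Real.log (-u') / u' ^ 2 = (Real.log (-u) + 1) / (-u) := by
  set g : ℝ → ℝ := fun u' ↦ (Real.log (-u') + 1) / (-u') with hg
  have hderiv : ∀ x ∈ Iic u, HasDerivAt g (Real.log (-x) / x ^ 2) x := by
    intro x hx
    have hx0 : x < 0 := by linarith [mem_Iic.1 hx]
    have hlog : HasDerivAt (fun x ↦ Real.log (-x) + 1) (x⁻¹) x := by
      have h := ((hasDerivAt_neg x).log (by linarith)).add_const 1
      refine h.congr_deriv ?_
      field_simp
    have h := hlog.div (hasDerivAt_neg x) (by linarith)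
    refine h.congr_deriv ?_
    have hx0' : x ≠ 0 := hx0.ne
    field_simp
    ring
  have hpos : ∀ x ∈ Iic u, 0 ≤ Real.log (-x) / x ^ 2 := fun x hx ↦
    div_nonneg (Real.log_nonneg (by linarith [mem_Iic.1 hx])) (sq_nonneg x)
  have hlim : Tendsto g atBot (𝓝 0) := by
    -- `(log w + 1)/w → 0` as `w → ∞`, composed with `w = −u'`
    have h1 : Tendsto (fun w : ℝ ↦ (Real.log w + 1) / w) atTop (𝓝 0) := by
      have ha : Tendsto (fun w : ℝ ↦ Real.log w / w) atTop (𝓝 0) := by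
        have := Real.tendsto_pow_log_div_mul_add_atTop 1 0 1 one_ne_zero
        simpa using this
      have hb : Tendsto (fun w : ℝ ↦ (1 : ℝ) / w) atTop (𝓝 0) := tendsto_const_nhds.div_atTop tendsto_id
      have := ha.add hb
      rw [add_zero] at this
      refine this.congr' ?_
      filter_upwards [eventually_gt_atTop 0] with w hw
      field_simp
    have h2 := h1.comp tendsto_neg_atBot_atTop
    refine h2.congr fun x ↦ ?_
    simp [hg]
  have hint : IntegrableOn (fun x ↦ Real.log (-x) / x ^ 2) (Iic u) :=
    integrableOn_Iic_deriv_of_nonneg' hderiv hpos hlim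
  refine ⟨hint, ?_⟩
  rw [integral_Iic_of_hasDerivAt_of_tendsto' hderiv hint hlim, sub_zero]

/-! ### The model integrals -/

section Model

/-- The model integrand `1/(|u'| (c + u − u')^j)`. [folklore] -/
def modelIntegrand (j : ℕ) (c u u' : ℝ) : ℝ := (-u')⁻¹ * ((c + (u - u')) ^ j)⁻¹

/-- **The model integral**: `𝒩_j(c) = ∫_{−∞}^{u} du'/(|u'| (c + u − u')^j)` equals
`(log c − log|u|)/c^j` up to `(1/j + j + 1)/c^j`, for `c ≥ |u| > 0`, `j ≥ 1`; with integrability.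
[folklore] -/
theorem abs_modelInt_sub_le {j : ℕ} (hj : 1 ≤ j) {c u : ℝ} (hu : u < 0) (hc : -u ≤ c) :
    IntegrableOn (modelIntegrand j c u) (Iic u) ∧
      |(∫ u' in Iic u, modelIntegrand j c u u') - (Real.log c - Real.log (-u)) * (c ^ j)⁻¹| ≤
        ((j : ℝ)⁻¹ + j + 1) * (c ^ j)⁻¹ := by
  have hc0 : 0 < c := lt_of_lt_of_le (by linarith) hc
  have hjr : (1 : ℝ) ≤ j := by exact_mod_cast hj
  obtain ⟨n, rfl⟩ : ∃ n, j = n + 1 := ⟨j - 1, by omega⟩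
  -- positivity of the base along `Iic u`
  have hbase : ∀ x, x ≤ u → 0 < c + (u - x) := fun x hx ↦ by linarith
  have hcont : ContinuousOn (modelIntegrand (n + 1) c u) (Iic u) := by
    intro x hx
    have hx' : x ≤ u := mem_Iic.1 hx
    have h1 : ContinuousAt (fun x : ℝ ↦ (-x)⁻¹) x :=
      (continuous_neg.continuousAt).inv₀ (by simp; linarith)
    have h2 : ContinuousAt (fun x : ℝ ↦ ((c + (u - x)) ^ (n + 1))⁻¹) x :=
      (((continuous_const.add (continuous_const.sub continuous_id)).pow _).continuousAt).inv₀
        (pow_ne_zero _ (hbase x hx').ne')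
    exact (h1.mul h2).continuousWithinAt
  -- (1) the tail `(−∞, u − c]`: `0 ≤ m ≤ |u'|^{-(j+1)}`
  have htail_le : ∀ x ∈ Iic (u - c), modelIntegrand (n + 1) c u x ≤ ((-x) ^ (n + 2))⁻¹ := by
    intro x hx
    have hx' : x ≤ u - c := mem_Iic.1 hx
    have hx0 : 0 < -x := by linarith
    have hb : -x ≤ c + (u - x) := by linarith
    simp only [modelIntegrand]
    rw [show ((-x) ^ (n + 2))⁻¹ = (-x)⁻¹ * ((-x) ^ (n + 1))⁻¹ by rw [pow_succ']; rw [mul_inv]]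
    refine mul_le_mul_of_nonneg_left ?_ (by positivity)
    exact inv_anti₀ (by positivity) (pow_le_pow_left₀ hx0.le hb _)
  have htail_nonneg : ∀ x, x ≤ u → 0 ≤ modelIntegrand (n + 1) c u x := fun x hx ↦ by
    simp only [modelIntegrand]
    have : 0 < -x := by linarith
    have := hbase x hx
    positivity
  obtain ⟨hintT, hvalT⟩ := integral_Iic_inv_pow n (show u - c < 0 by linarith)
  have hint1 : IntegrableOn (modelIntegrand (n + 1) c u) (Iic (u - c)) := by
    refine Integrable.mono' hintT ?_ ?_
    · exact (hcont.mono (Iic_subset_Iic.2 (by linarith))).aestronglyMeasurable measurableSet_Iic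
    · refine (ae_restrict_iff' measurableSet_Iic).2 (Eventually.of_forall fun x hx ↦ ?_)
      rw [Real.norm_eq_abs, abs_of_nonneg (htail_nonneg x ((mem_Iic.1 hx).trans (by linarith)))]
      exact htail_le x hx
  have hT1 : 0 ≤ ∫ x in Iic (u - c), modelIntegrand (n + 1) c u x ∧
      ∫ x in Iic (u - c), modelIntegrand (n + 1) c u x ≤ (((n : ℝ) + 1) * c ^ (n + 1))⁻¹ := by
    refine ⟨setIntegral_nonneg measurableSet_Iic fun x hx ↦ htail_nonneg x ((mem_Iic.1 hx).trans (by linarith)), ?_⟩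
    calc ∫ x in Iic (u - c), modelIntegrand (n + 1) c u x ≤ ∫ x in Iic (u - c), ((-x) ^ (n + 2))⁻¹ :=
          setIntegral_mono_on hint1 hintT measurableSet_Iic htail_le
      _ = (((n : ℝ) + 1) * (-(u - c)) ^ (n + 1))⁻¹ := hvalT
      _ ≤ (((n : ℝ) + 1) * c ^ (n + 1))⁻¹ := by
          have h1 : c ≤ -(u - c) := by linarith
          have h2 : c ^ (n + 1) ≤ (-(u - c)) ^ (n + 1) := pow_le_pow_left₀ hc0.le h1 _
          exact inv_anti₀ (by positivity) (mul_le_mul_of_nonneg_left h2 (by positivity))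
  -- (2) the main part `[u − c, u]`
  have hle : u - c ≤ u := by linarith
  have hcont2 : ContinuousOn (modelIntegrand (n + 1) c u) (uIcc (u - c) u) := by
    rw [uIcc_of_le hle]; exact hcont.mono Icc_subset_Iic_self
  have hint2 : IntervalIntegrable (modelIntegrand (n + 1) c u) volume (u - c) u :=
    hcont2.intervalIntegrable
  -- comparison integrand `(−u')⁻¹ c^{-j}`
  have hcont3 : ContinuousOn (fun x : ℝ ↦ (-x)⁻¹ * (c ^ (n + 1))⁻¹) (uIcc (u - c) u) := by
    rw [uIcc_of_le hle]
    intro x hx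
    exact (((continuous_neg.continuousAt).inv₀ (by simp; linarith [hx.2])).mul
      continuousAt_const).continuousWithinAt
  have hint3 : IntervalIntegrable (fun x : ℝ ↦ (-x)⁻¹ * (c ^ (n + 1))⁻¹) volume (u - c) u :=
    hcont3.intervalIntegrable
  have hval3 : ∫ x in (u - c)..u, (-x)⁻¹ * (c ^ (n + 1))⁻¹ =
      (Real.log (c + -u) - Real.log (-u)) * (c ^ (n + 1))⁻¹ := by
    rw [intervalIntegral.integral_mul_const]
    have h0 : (0 : ℝ) ∉ uIcc (u - c) u := by
      rw [uIcc_of_le hle]; intro h; linarith [h.2]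
    have h := integral_inv h0
    have hfun : (fun x : ℝ ↦ (-x)⁻¹) = fun x ↦ -x⁻¹ := by funext x; rw [inv_neg]
    rw [hfun, intervalIntegral.integral_neg, h]
    congr 1
    rw [Real.log_div (by linarith) (by linarith), show u - c = -(c + -u) by ring, Real.log_neg_eq_log,
      ← Real.log_neg_eq_log u]
    ring
  -- pointwise: `0 ≤ (−x)⁻¹ c^{-j} − m(x) ≤ j c^{-(j+1)}` on `[u − c, u]`
  have hdiff : ∀ x ∈ Icc (u - c) u, 0 ≤ (-x)⁻¹ * (c ^ (n + 1))⁻¹ - modelIntegrand (n + 1) c u x ∧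
      (-x)⁻¹ * (c ^ (n + 1))⁻¹ - modelIntegrand (n + 1) c u x ≤ ((n : ℝ) + 1) * (c ^ (n + 2))⁻¹ := by
    intro x hx
    have hx0 : 0 < -x := by linarith [hx.2]
    set s := u - x with hs
    have hs0 : 0 ≤ s := by linarith [hx.2]
    have hsc : s ≤ c := by linarith [hx.1]
    have hcs : 0 < c + s := by linarith
    simp only [modelIntegrand, ← mul_sub]
    -- Bernoulli: `c^{-j} − (c+s)^{-j} ≤ j s c^{-(j+1)}`
    have hbern : (c ^ (n + 1))⁻¹ - ((c + s) ^ (n + 1))⁻¹ ≤ ((n : ℝ) + 1) * s * (c ^ (n + 2))⁻¹ := by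
      have hq : (c / (c + s)) ^ (n + 1) = c ^ (n + 1) * ((c + s) ^ (n + 1))⁻¹ := by
        rw [div_pow, div_eq_mul_inv]
      have hB := one_add_mul_le_pow (show (-2 : ℝ) ≤ c / (c + s) - 1 by
        have : 0 ≤ c / (c + s) := by positivity
        linarith) (n + 1)
      rw [add_sub_cancel] at hB
      push_cast at hB
      have hB' : 1 - (c / (c + s)) ^ (n + 1) ≤ ((n : ℝ) + 1) * (1 - c / (c + s)) := by linarith
      have hcj : 0 < c ^ (n + 1) := by positivity
      have hfac : (c ^ (n + 1))⁻¹ - ((c + s) ^ (n + 1))⁻¹ = (c ^ (n + 1))⁻¹ * (1 - (c / (c + s)) ^ (n + 1)) := by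
        rw [hq]; field_simp
      have h2 : 1 - c / (c + s) ≤ s / c := by
        rw [one_sub_div hcs.ne', add_sub_cancel_left]
        exact div_le_div_of_nonneg_left hs0 hc0 (by linarith)
      rw [hfac]
      calc (c ^ (n + 1))⁻¹ * (1 - (c / (c + s)) ^ (n + 1)) ≤ (c ^ (n + 1))⁻¹ * (((n : ℝ) + 1) * (1 - c / (c + s))) :=
            mul_le_mul_of_nonneg_left hB' (by positivity)
        _ ≤ (c ^ (n + 1))⁻¹ * (((n : ℝ) + 1) * (s / c)) :=
            mul_le_mul_of_nonneg_left (mul_le_mul_of_nonneg_left h2 (by positivity)) (by positivity)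
        _ = ((n : ℝ) + 1) * s * (c ^ (n + 2))⁻¹ := by rw [pow_succ]; field_simp; ring
    have hnn : 0 ≤ (c ^ (n + 1))⁻¹ - ((c + s) ^ (n + 1))⁻¹ :=
      sub_nonneg.2 (inv_anti₀ (by positivity) (pow_le_pow_left₀ hc0.le (by linarith) _))
    refine ⟨mul_nonneg (by positivity) hnn, ?_⟩
    have hsx : (-x)⁻¹ * s ≤ 1 := by
      rw [inv_mul_le_iff₀ hx0]; linarith [hu]
    calc (-x)⁻¹ * ((c ^ (n + 1))⁻¹ - ((c + s) ^ (n + 1))⁻¹) ≤ (-x)⁻¹ * (((n : ℝ) + 1) * s * (c ^ (n + 2))⁻¹) :=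
          mul_le_mul_of_nonneg_left hbern (by positivity)
      _ = ((-x)⁻¹ * s) * (((n : ℝ) + 1) * (c ^ (n + 2))⁻¹) := by ring
      _ ≤ 1 * (((n : ℝ) + 1) * (c ^ (n + 2))⁻¹) := mul_le_mul_of_nonneg_right hsx (by positivity)
      _ = ((n : ℝ) + 1) * (c ^ (n + 2))⁻¹ := one_mul _
  have hT2 : 0 ≤ (∫ x in (u - c)..u, (-x)⁻¹ * (c ^ (n + 1))⁻¹) - ∫ x in (u - c)..u, modelIntegrand (n + 1) c u x ∧
      (∫ x in (u - c)..u, (-x)⁻¹ * (c ^ (n + 1))⁻¹) - ∫ x in (u - c)..u, modelIntegrand (n + 1) c u x ≤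
        ((n : ℝ) + 1) * (c ^ (n + 1))⁻¹ := by
    rw [← intervalIntegral.integral_sub hint3 hint2]
    refine ⟨intervalIntegral.integral_nonneg hle fun x hx ↦ (hdiff x hx).1, ?_⟩
    have h := intervalIntegral.integral_mono_on hle (hint3.sub hint2)
      (intervalIntegrable_const (c := ((n : ℝ) + 1) * (c ^ (n + 2))⁻¹)) fun x hx ↦ (hdiff x hx).2
    refine h.trans (le_of_eq ?_)
    rw [intervalIntegral.integral_const, smul_eq_mul, pow_succ]
    field_simp
    ring
  -- (3) `log(c + |u|) − log|u| = (log c − log|u|) + log(1 + |u|/c)`, `0 ≤ log(1+|u|/c) ≤ 1`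
  have hlog : 0 ≤ Real.log (c + -u) - Real.log c ∧ Real.log (c + -u) - Real.log c ≤ 1 := by
    rw [← Real.log_div (by linarith) hc0.ne']
    refine ⟨Real.log_nonneg ?_, ?_⟩
    · rw [le_div_iff₀ hc0]; linarith
    · have h1 : (c + -u) / c ≤ 2 := by rw [div_le_iff₀ hc0]; linarith
      calc Real.log ((c + -u) / c) ≤ Real.log 2 := Real.log_le_log (div_pos (by linarith) hc0) h1
        _ ≤ 1 := Real.log_two_lt_d9.le.trans (by norm_num)
  -- assemble: `∫_{Iic u} = ∫_{Iic (u-c)} + ∫_{u-c}^{u}`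
  have hint : IntegrableOn (modelIntegrand (n + 1) c u) (Iic u) := by
    have h2 : IntegrableOn (modelIntegrand (n + 1) c u) (Icc (u - c) u) :=
      (hcont.mono Icc_subset_Iic_self).integrableOn_Icc
    refine (hint1.union h2).mono_set fun x hx ↦ ?_
    rcases le_or_gt x (u - c) with h | h
    · exact Or.inl h
    · exact Or.inr ⟨h.le, hx⟩
  refine ⟨hint, ?_⟩
  have hsplit : ∫ x in Iic u, modelIntegrand (n + 1) c u x =
      (∫ x in Iic (u - c), modelIntegrand (n + 1) c u x) + ∫ x in (u - c)..u, modelIntegrand (n + 1) c u x := by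
    rw [← intervalIntegral.integral_Iic_sub_Iic hint1 hint]; ring
  rw [hsplit]
  have hinvj : 0 < (c ^ (n + 1))⁻¹ := by positivity
  have hjinv : (((n : ℝ) + 1) * c ^ (n + 1))⁻¹ = ((n : ℝ) + 1)⁻¹ * (c ^ (n + 1))⁻¹ := mul_inv _ _
  rw [abs_le]
  push_cast
  constructor
  · nlinarith [hT1.1, hT2.2, hlog.1, hval3, hinvj]
  · nlinarith [hT1.2, hT2.1, hlog.2, hval3, hinvj, hjinv, inv_nonneg.2 (show (0:ℝ) ≤ (n : ℝ) + 1 by positivity)]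

end Model

/-! ### The integrals `I_j` and `J_k` -/

section LogIntegrals

variable {M : ℝ} {r : ℝ → ℝ → ℝ} (hr : IsEFAreaRadius M r) (hM : 0 < M)

/-- `I_j(u, v) = ∫_{−∞}^{u} (1 − 2M/r(u',v)) r(u',v)^{−j}/|u'| du'`. [folklore] -/
def Iint (M : ℝ) (r : ℝ → ℝ → ℝ) (j : ℕ) (u v : ℝ) : ℝ :=
  ∫ u' in Iic u, (-u')⁻¹ * ((r u' v ^ j)⁻¹ * (1 - 2 * M / r u' v))

/-- `J_k(u, v) = ∫_{−∞}^{u} u'⁻² (r(u',v)^{−k} − r(u,v)^{−k}) du'`. [folklore] -/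
def Jint (r : ℝ → ℝ → ℝ) (k : ℕ) (u v : ℝ) : ℝ :=
  ∫ u' in Iic u, (u' ^ 2)⁻¹ * ((r u' v ^ k)⁻¹ - (r u v ^ k)⁻¹)

include hr hM

/-- Continuity of `u' ↦ r(u', v)`. [folklore] -/
lemma continuous_radius_left (v : ℝ) : Continuous fun u' ↦ r u' v :=
  continuous_slice_left (hr.contDiff_uncurry hM).continuous v

/-- The integrand of `I_j` is integrable on `(−∞, u]` for `u < 0`, `j ≥ 2`, `r(u,v) ≥ 4M`, and is
dominated by `ρ^j/|u|`. [folklore] -/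
lemma integrableOn_Iint (n : ℕ) {u v : ℝ} (hu : u < 0) (h4 : 4 * M ≤ r u v) :
    IntegrableOn (fun u' ↦ (-u')⁻¹ * ((r u' v ^ (n + 2))⁻¹ * (1 - 2 * M / r u' v))) (Iic u) := by
  obtain ⟨hint, -⟩ := integral_Iic_inv_pow_ray hr hM n h4
  have hc : ContinuousOn (fun u' ↦ (-u')⁻¹ * ((r u' v ^ (n + 2))⁻¹ * (1 - 2 * M / r u' v))) (Iic u) := by
    intro x hx
    have hx0 : -x ≠ 0 := by have := mem_Iic.1 hx; intro h; linarith
    have hcr := continuous_radius_left hr hM v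
    have hne : ∀ y, r y v ≠ 0 := fun y ↦ (hr.pos hM.le y v).ne'
    refine ContinuousAt.continuousWithinAt ?_
    exact ((continuous_neg.continuousAt).inv₀ hx0).mul
      ((((hcr.pow _).continuousAt).inv₀ (pow_ne_zero _ (hne x))).mul
        (continuousAt_const.sub ((continuousAt_const.div hcr.continuousAt (hne x)))))
  refine Integrable.mono' (hint.const_mul ((-u)⁻¹)) (hc.aestronglyMeasurable measurableSet_Iic) ?_
  refine (ae_restrict_iff' measurableSet_Iic).2 (Eventually.of_forall fun x hx ↦ ?_)
  have hx' : x ≤ u := mem_Iic.1 hx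
  have hx0 : 0 < -x := by linarith
  have hρ : 0 ≤ (r x v ^ (n + 2))⁻¹ := by have := hr.pos hM.le x v; positivity
  have hD0 := (hr.factor_pos hM.le x v).le
  have hD1 := factor_le_one hr hM x v
  rw [Real.norm_eq_abs, abs_of_nonneg (by positivity)]
  calc (-x)⁻¹ * ((r x v ^ (n + 2))⁻¹ * (1 - 2 * M / r x v)) ≤ (-u)⁻¹ * ((r x v ^ (n + 2))⁻¹ * 1) := by
        refine mul_le_mul (inv_anti₀ (by linarith) (by linarith)) (mul_le_mul_of_nonneg_left hD1 hρ)
          (mul_nonneg hρ hD0) (inv_nonneg.2 (by linarith))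
    _ = (-u)⁻¹ * (r x v ^ (n + 2))⁻¹ := by rw [mul_one]

/-- **Integration by parts: `J_{k+1} = −(k+1) I_{k+2}`** (boundary terms vanish: at `u' = u` the
bracket does, at `−∞` the weight `1/|u'|` does). [folklore] -/
theorem Jint_eq (k : ℕ) {u v : ℝ} (hu : u < 0) (h4 : 4 * M ≤ r u v) :
    Jint r (k + 1) u v = -((k : ℝ) + 1) * Iint M r (k + 2) u v := by
  -- `Φ(u') = (−u')⁻¹ (ρ^{k+1} − ρ₀^{k+1})`
  set Φ : ℝ → ℝ := fun u' ↦ (-u')⁻¹ * ((r u' v ^ (k + 1))⁻¹ - (r u v ^ (k + 1))⁻¹) with hΦ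
  set A : ℝ → ℝ := fun u' ↦ (u' ^ 2)⁻¹ * ((r u' v ^ (k + 1))⁻¹ - (r u v ^ (k + 1))⁻¹) with hA
  set B : ℝ → ℝ := fun u' ↦ (-u')⁻¹ * ((r u' v ^ (k + 2))⁻¹ * (1 - 2 * M / r u' v)) with hB
  have hderiv : ∀ x ∈ Iic u, HasDerivAt Φ (A x + ((k : ℝ) + 1) * B x) x := by
    intro x hx
    have hx0 : x < 0 := lt_of_le_of_lt (mem_Iic.1 hx) hu
    have h1 : HasDerivAt (fun x : ℝ ↦ (-x)⁻¹) ((x ^ 2)⁻¹) x := by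
      have h := (hasDerivAt_neg x).inv (by linarith)
      refine h.congr_deriv ?_
      field_simp
    have h2 := (hasDerivAt_inv_pow_left hr hM k x v).sub_const ((r u v ^ (k + 1))⁻¹)
    refine (h1.mul h2).congr_deriv ?_
    simp only [hA, hB]
    ring
  -- integrability of `A` and `B`
  obtain ⟨hintu, -⟩ := integral_Iic_inv_pow 0 hu
  have hcr := continuous_radius_left hr hM v
  have hne : ∀ y, r y v ≠ 0 := fun y ↦ (hr.pos hM.le y v).ne'
  have hAc : ContinuousOn A (Iic u) := by
    intro x hx
    have hx0 : x ≠ 0 := by have := mem_Iic.1 hx; intro h; linarith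
    exact ((((continuous_pow 2).continuousAt).inv₀ (pow_ne_zero _ hx0)).mul
      ((((hcr.pow _).continuousAt).inv₀ (pow_ne_zero _ (hne x))).sub continuousAt_const)).continuousWithinAt
  have hintA : IntegrableOn A (Iic u) := by
    refine Integrable.mono' (hintu.const_mul ((r u v ^ (k + 1))⁻¹)) (hAc.aestronglyMeasurable measurableSet_Iic) ?_
    refine (ae_restrict_iff' measurableSet_Iic).2 (Eventually.of_forall fun x hx ↦ ?_)
    have hx' : x ≤ u := mem_Iic.1 hx
    have hsub0 : 0 ≤ (r u v ^ (k + 1))⁻¹ - (r x v ^ (k + 1))⁻¹ := inv_pow_sub_nonneg hr hM _ hx'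
    have hsub1 : (r u v ^ (k + 1))⁻¹ - (r x v ^ (k + 1))⁻¹ ≤ (r u v ^ (k + 1))⁻¹ := by
      have : 0 ≤ (r x v ^ (k + 1))⁻¹ := by have := hr.pos hM.le x v; positivity
      linarith
    simp only [hA]
    rw [Real.norm_eq_abs, abs_mul, abs_of_nonneg (by positivity), abs_sub_comm, abs_of_nonneg hsub0,
      mul_comm ((r u v ^ (k + 1))⁻¹)]
    refine mul_le_mul_of_nonneg_left hsub1 (by positivity) |>.trans (le_of_eq ?_)
    norm_num
  have hintB : IntegrableOn B (Iic u) := integrableOn_Iint hr hM k hu h4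
  have hint : IntegrableOn (fun x ↦ A x + ((k : ℝ) + 1) * B x) (Iic u) := hintA.add (hintB.const_mul _)
  -- limit of `Φ` at `−∞`: bounded bracket times `1/|u'| → 0`
  have hlim : Tendsto Φ atBot (𝓝 0) := by
    have h1 : Tendsto (fun x : ℝ ↦ (-x)⁻¹) atBot (𝓝 0) := tendsto_neg_atBot_atTop.inv_tendsto_atTop
    have hbdd : ∀ x, x ≤ u → |(r x v ^ (k + 1))⁻¹ - (r u v ^ (k + 1))⁻¹| ≤ (r u v ^ (k + 1))⁻¹ := by
      intro x hx
      rw [abs_sub_comm, abs_of_nonneg (inv_pow_sub_nonneg hr hM _ hx)]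
      have : 0 ≤ (r x v ^ (k + 1))⁻¹ := by have := hr.pos hM.le x v; positivity
      linarith
    have h2 : Tendsto (fun x : ℝ ↦ (-x)⁻¹ * (r u v ^ (k + 1))⁻¹) atBot (𝓝 0) := by
      simpa using h1.mul_const ((r u v ^ (k + 1))⁻¹)
    refine squeeze_zero_norm' ?_ h2
    filter_upwards [eventually_le_atBot u] with x hx
    have hx0 : 0 < -x := by linarith
    rw [Real.norm_eq_abs, hΦ]
    simp only
    rw [abs_mul, abs_of_pos (inv_pos.2 hx0)]
    exact mul_le_mul_of_nonneg_left (hbdd x hx) (by positivity)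
  have h := integral_Iic_of_hasDerivAt_of_tendsto' hderiv hint hlim
  have hΦu : Φ u = 0 := by simp [hΦ]
  rw [hΦu, zero_sub, integral_add hintA (hintB.const_mul _), MeasureTheory.integral_const_mul] at h
  simp only [Jint, Iint]
  linarith

/-- **`I_j = Λ ρ₀^j + O(ρ₀^j)` at fixed `u`** (`j ≥ 2`, `u < 0`): for `r(u, v) ≥ max(4M, |u|)`,
`|I_j(u,v) − (log r(u,v) − log|u|)/r(u,v)^j| ≤ C/r(u,v)^j`, by the squeeze between the model
integrals with `c = r₀` and `c = r₀/θ`, `θ = 1 − 2M/r₀`. [folklore] -/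
theorem abs_Iint_sub_le (n : ℕ) {u : ℝ} (hu : u < 0) :
    ∃ C : ℝ, ∀ v, 4 * M ≤ r u v → -u ≤ r u v →
      |Iint M r (n + 2) u v - logRatio r u v * (r u v ^ (n + 2))⁻¹| ≤ C * (r u v ^ (n + 2))⁻¹ := by
  obtain ⟨L, hL0, hL⟩ := exists_abs_logRatio_mul_inv_le hr hM u
  set K : ℝ := ((n : ℝ) + 2)⁻¹ + (n + 2) + 1 with hK
  have hK0 : 0 ≤ K := by positivity
  refine ⟨max (Real.log 2 + 2 * K) (2 * M * L + K), fun v h4 huv ↦ ?_⟩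
  set r₀ := r u v with hr₀
  have hr₀0 : 0 < r₀ := hr.pos hM.le u v
  set θ := 1 - 2 * M / r₀ with hθ
  have hθ1 : θ ≤ 1 := factor_le_one hr hM u v
  have hθ2 : 1 / 2 ≤ θ := factor_ge_half hM h4
  have hθ0 : 0 < θ := by linarith
  -- the two model integrals
  have hcu : -u ≤ r₀ := huv
  have hcu' : -u ≤ r₀ / θ := hcu.trans (by rw [le_div_iff₀ hθ0]; nlinarith)
  obtain ⟨hintl, hl⟩ := abs_modelInt_sub_le (j := n + 2) (by omega) hu hcu
  obtain ⟨hintu', hu'⟩ := abs_modelInt_sub_le (j := n + 2) (by omega) hu hcu'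
  push_cast at hl hu'
  rw [← hK] at hl hu'
  have hintI := integrableOn_Iint hr hM n hu h4
  -- pointwise squeeze on `Iic u`
  have hlow : ∀ x ∈ Iic u, θ * modelIntegrand (n + 2) r₀ u x ≤
      (-x)⁻¹ * ((r x v ^ (n + 2))⁻¹ * (1 - 2 * M / r x v)) := by
    intro x hx
    have hx' : x ≤ u := mem_Iic.1 hx
    have hx0 : 0 < -x := by linarith
    have hrx : 0 < r x v := hr.pos hM.le x v
    have hup : r x v ≤ r₀ + (u - x) := radius_ray_le hr hM hx'
    have hD : θ ≤ 1 - 2 * M / r x v := factor_ray_ge hr hM hx'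
    simp only [modelIntegrand]
    have h1 : ((r₀ + (u - x)) ^ (n + 2))⁻¹ ≤ (r x v ^ (n + 2))⁻¹ :=
      inv_anti₀ (by positivity) (pow_le_pow_left₀ hrx.le hup _)
    calc θ * ((-x)⁻¹ * ((r₀ + (u - x)) ^ (n + 2))⁻¹) = (-x)⁻¹ * (((r₀ + (u - x)) ^ (n + 2))⁻¹ * θ) := by ring
      _ ≤ (-x)⁻¹ * ((r x v ^ (n + 2))⁻¹ * (1 - 2 * M / r x v)) :=
          mul_le_mul_of_nonneg_left (mul_le_mul h1 hD hθ0.le (by positivity)) (by positivity)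
  have hupp : ∀ x ∈ Iic u, (-x)⁻¹ * ((r x v ^ (n + 2))⁻¹ * (1 - 2 * M / r x v)) ≤
      θ⁻¹ ^ (n + 2) * modelIntegrand (n + 2) (r₀ / θ) u x := by
    intro x hx
    have hx' : x ≤ u := mem_Iic.1 hx
    have hx0 : 0 < -x := by linarith
    have hrx : 0 < r x v := hr.pos hM.le x v
    have hlo : r₀ + θ * (u - x) ≤ r x v := radius_ray_ge hr hM hx'
    have hD1 : 1 - 2 * M / r x v ≤ 1 := factor_le_one hr hM x v
    have hpos : 0 < r₀ + θ * (u - x) := by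
      have : 0 ≤ u - x := by linarith
      positivity
    simp only [modelIntegrand]
    have heq : θ⁻¹ ^ (n + 2) * ((-x)⁻¹ * ((r₀ / θ + (u - x)) ^ (n + 2))⁻¹) =
        (-x)⁻¹ * ((r₀ + θ * (u - x)) ^ (n + 2))⁻¹ := by
      have h1 : r₀ / θ + (u - x) = (r₀ + θ * (u - x)) * θ⁻¹ := by field_simp
      rw [h1, mul_pow, mul_inv]
      have h2 : θ⁻¹ ^ (n + 2) * (θ⁻¹ ^ (n + 2))⁻¹ = 1 := mul_inv_cancel₀ (pow_ne_zero _ (inv_ne_zero hθ0.ne'))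
      linear_combination ((-x)⁻¹ * ((r₀ + θ * (u - x)) ^ (n + 2))⁻¹) * h2
    rw [heq]
    have h1 : (r x v ^ (n + 2))⁻¹ ≤ ((r₀ + θ * (u - x)) ^ (n + 2))⁻¹ :=
      inv_anti₀ (by positivity) (pow_le_pow_left₀ hpos.le hlo _)
    calc (-x)⁻¹ * ((r x v ^ (n + 2))⁻¹ * (1 - 2 * M / r x v)) ≤ (-x)⁻¹ * ((r x v ^ (n + 2))⁻¹ * 1) :=
          mul_le_mul_of_nonneg_left (mul_le_mul_of_nonneg_left hD1 (by positivity)) (by positivity)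
      _ ≤ (-x)⁻¹ * ((r₀ + θ * (u - x)) ^ (n + 2))⁻¹ := by
          rw [mul_one]; exact mul_le_mul_of_nonneg_left h1 (by positivity)
  have hI_low : θ * ∫ x in Iic u, modelIntegrand (n + 2) r₀ u x ≤ Iint M r (n + 2) u v := by
    rw [Iint, ← MeasureTheory.integral_const_mul]
    exact setIntegral_mono_on (hintl.const_mul θ) hintI measurableSet_Iic hlow
  have hI_upp : Iint M r (n + 2) u v ≤ θ⁻¹ ^ (n + 2) * ∫ x in Iic u, modelIntegrand (n + 2) (r₀ / θ) u x := by
    rw [Iint, ← MeasureTheory.integral_const_mul]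
    exact setIntegral_mono_on hintI (hintu'.const_mul _) measurableSet_Iic hupp
  -- the logarithms: `log(r₀/θ) = log r₀ − log θ`, `0 ≤ −log θ ≤ log 2`
  have hlogθ : 0 ≤ -Real.log θ ∧ -Real.log θ ≤ Real.log 2 := by
    constructor
    · have := Real.log_nonpos hθ0.le hθ1; linarith
    · rw [← Real.log_inv]
      exact Real.log_le_log (by positivity) (by rw [inv_le_comm₀ hθ0 two_pos]; linarith)
  have hΛ : logRatio r u v = Real.log r₀ - Real.log (-u) := by
    simp only [logRatio, hr₀, abs_of_neg hu]
  have hlogdiv : Real.log (r₀ / θ) = Real.log r₀ - Real.log θ := Real.log_div hr₀0.ne' hθ0.ne'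
  -- `|Λ| ρ₀ ≤ L`
  have hΛρ : |logRatio r u v| * r₀⁻¹ ≤ L := hL v
  have hρpos : 0 < (r₀ ^ (n + 2))⁻¹ := by positivity
  -- rewrite the model bounds
  set N₁ := ∫ x in Iic u, modelIntegrand (n + 2) r₀ u x with hN₁
  set N₂ := ∫ x in Iic u, modelIntegrand (n + 2) (r₀ / θ) u x with hN₂
  have hl' := abs_le.1 hl
  have hu'' := abs_le.1 hu'
  -- `(r₀/θ)^{-(n+2)} = θ^{n+2} ρ₀^{n+2}`
  have hpowθ : ((r₀ / θ) ^ (n + 2))⁻¹ = θ ^ (n + 2) * (r₀ ^ (n + 2))⁻¹ := by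
    rw [div_pow, inv_div, div_eq_mul_inv]
  have hθpow_le : θ ^ (n + 2) ≤ 1 := pow_le_one₀ hθ0.le hθ1
  have hθpow_pos : 0 < θ ^ (n + 2) := pow_pos hθ0 _
  have hθinv : θ⁻¹ ^ (n + 2) * θ ^ (n + 2) = 1 := by rw [inv_pow, inv_mul_cancel₀ hθpow_pos.ne']
  set X := (r₀ ^ (n + 2))⁻¹ with hX
  set Λ₀ := Real.log r₀ - Real.log (-u) with hΛ₀
  set Cm := max (Real.log 2 + 2 * K) (2 * M * L + K) with hCm
  rw [hΛ] at hΛρ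
  rw [hΛ, abs_le]
  constructor
  · -- lower bound: `I ≥ θ N₁ ≥ θ(Λ₀ X − K X) = Λ₀X − (1−θ)Λ₀ X − θ K X ≥ Λ₀ X − 2ML X − K X`
    have s1 : θ * (Λ₀ * X - K * X) ≤ Iint M r (n + 2) u v :=
      le_trans (mul_le_mul_of_nonneg_left (by linarith [hl'.1]) hθ0.le) hI_low
    have s2 : θ * (Λ₀ * X - K * X) = Λ₀ * X - ((1 - θ) * Λ₀) * X - (θ * K) * X := by ring
    have hθeq : 1 - θ = 2 * M * r₀⁻¹ := by simp only [hθ]; field_simp; ring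
    have s3 : (1 - θ) * Λ₀ ≤ 2 * M * L := by
      have ha : (1 - θ) * Λ₀ ≤ (1 - θ) * |Λ₀| := mul_le_mul_of_nonneg_left (le_abs_self _) (sub_nonneg.2 hθ1)
      have hb : (1 - θ) * |Λ₀| = 2 * M * (|Λ₀| * r₀⁻¹) := by rw [hθeq]; ring
      have hc' : 2 * M * (|Λ₀| * r₀⁻¹) ≤ 2 * M * L := mul_le_mul_of_nonneg_left hΛρ (by positivity)
      linarith
    have s4 : θ * K ≤ K := mul_le_of_le_one_left hK0 hθ1
    have hA : (1 - θ) * Λ₀ * X ≤ 2 * M * L * X := mul_le_mul_of_nonneg_right s3 hρpos.le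
    have hB : θ * K * X ≤ K * X := mul_le_mul_of_nonneg_right s4 hρpos.le
    have hC : (2 * M * L + K) * X ≤ Cm * X := mul_le_mul_of_nonneg_right (le_max_right _ _) hρpos.le
    rw [add_mul] at hC
    linarith [s1, s2, hA, hB, hC]
  · -- upper bound: `I ≤ θ^{-j} N₂ ≤ (Λ₀ − log θ) X + K X ≤ Λ₀ X + (log 2 + K) X`
    set Y := ((r₀ / θ) ^ (n + 2))⁻¹ with hY
    have s1 : Iint M r (n + 2) u v ≤ θ⁻¹ ^ (n + 2) * ((Real.log (r₀ / θ) - Real.log (-u)) * Y + K * Y) :=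
      hI_upp.trans (mul_le_mul_of_nonneg_left (by linarith [hu''.2]) (by positivity))
    have s2 : θ⁻¹ ^ (n + 2) * ((Real.log (r₀ / θ) - Real.log (-u)) * Y + K * Y) =
        Λ₀ * X + (-Real.log θ) * X + K * X := by
      rw [hpowθ, hlogdiv]
      calc θ⁻¹ ^ (n + 2) * ((Real.log r₀ - Real.log θ - Real.log (-u)) * (θ ^ (n + 2) * X) + K * (θ ^ (n + 2) * X))
          = (θ⁻¹ ^ (n + 2) * θ ^ (n + 2)) * ((Real.log r₀ - Real.log θ - Real.log (-u)) * X + K * X) := by ring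
        _ = Λ₀ * X + (-Real.log θ) * X + K * X := by rw [hθinv, one_mul]; simp only [hΛ₀]; ring
    have hD : (-Real.log θ) * X ≤ Real.log 2 * X := mul_le_mul_of_nonneg_right hlogθ.2 hρpos.le
    have hE : (Real.log 2 + K) * X ≤ Cm * X :=
      mul_le_mul_of_nonneg_right ((by linarith : Real.log 2 + K ≤ Real.log 2 + 2 * K).trans (le_max_left _ _)) hρpos.le
    rw [add_mul] at hE
    linarith [s1, s2, hD, hE]

/-- **`J_{k+1} = −(k+1) Λ ρ₀^{k+2} + O(ρ₀^{k+2})` at fixed `u`** (`u < 0`): for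
`r(u, v) ≥ max(4M, |u|)`. [folklore] -/
theorem abs_Jint_add_le (k : ℕ) {u : ℝ} (hu : u < 0) :
    ∃ C : ℝ, ∀ v, 4 * M ≤ r u v → -u ≤ r u v →
      |Jint r (k + 1) u v + ((k : ℝ) + 1) * logRatio r u v * (r u v ^ (k + 2))⁻¹| ≤ C * (r u v ^ (k + 2))⁻¹ := by
  obtain ⟨C, hC⟩ := abs_Iint_sub_le hr hM k hu
  refine ⟨((k : ℝ) + 1) * C, fun v h4 huv ↦ ?_⟩
  have h := hC v h4 huv
  rw [Jint_eq hr hM k hu h4]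
  have : -((k : ℝ) + 1) * Iint M r (k + 2) u v + ((k : ℝ) + 1) * logRatio r u v * (r u v ^ (k + 2))⁻¹ =
      -((k : ℝ) + 1) * (Iint M r (k + 2) u v - logRatio r u v * (r u v ^ (k + 2))⁻¹) := by ring
  rw [this, abs_mul, abs_neg, abs_of_nonneg (by positivity), mul_assoc]
  exact mul_le_mul_of_nonneg_left h (by positivity)

end LogIntegrals

end VExp

end Literature.Barriers.FinalStateConjecture

end
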